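import Literature.AlgebraicGeometry.HodgeTheory.IntegralModelSpecialPointLieSignature
import HarnessLib

/-!
# Socket (S-T), count-generic: the Lie rank of a block at a special point of an integral model IS the Kottwitz count
# `Σ_{τ inducing the block} r_τ` — in particular `0` on an étale banal block (Kottwitz 1992 §5; RSZ 2020 §4.1 (4.6); Liu 2021 p. 137)

Topic `Literature/AlgebraicGeometry/HodgeTheory`; namespaces `Literature.AlgebraicGeometry.AbelianSchemes.AbelianSchemeOver.RingAction` (§1) and
`Literature.AlgebraicGeometry.HodgeTheory.RingAction` (§2–§3), as in ★ FILE 1 `RingActionLieSignatureSpecialPoint` ∕ ★ FILE 2 (S-T)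
`IntegralModelSpecialPointLieSignature` (p846836), of which this file is the COUNT-GENERIC TWIN.  THEOREMS ONLY (no definition, no named fact, no
instance, no notation, no `sorry`).  Cell `hodgecm-mathlib` (D-0151), FLOOR 0, P6 «MOD programme» (crux hLiu418 = stmt-HodgeConjecture-24832,
`--supports`, count-neutral): the `hsig0` INPUT of ★ `BanalBlockFrobeniusKernelLaw` (p848099; LEAD F0P6-plan (g3) «M-57c» row 38 (π2-G)
`frobKernel_banal`) at the special points `x̄ = red₀ y` of the localised model — «the `u`-block of `Lie A_x̄` VANISHES when no embedding inducing `u`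
carries signature» — in the SAME currency as the spine's `blockDock_of_inputs` feeds ★ FILE 2 (`s := univ`, `c τ := τR τ (a 1)`, `m`, `hK` from
`kottwitzΩ`).  HC_CM is proved only modulo the printed citations (2 remaining named inputs hLiu418 24832, h413 24833) until rung 0 closes; this file
is generic and changes no count.

THE MATHEMATICS ([Kottwitz1992] §5 p. 390; [RapoportSmithlingZhang2020Diagonal] §4.1 (4.6) p. 16, (4.19) p. 19; [Liu2021] Remark C.2 p. 108, p. 137).
★ FILE 2 proves, for a block family `(a_n)` of a maximal ideal `w′` (`(p) = w′^e 𝔟`), that the cotangent map of `ι(a_n)` on `𝔪_e∕𝔪_e²` of the special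
fibre at `x̄` has rank `1` from the Kottwitz factorisation `char(ι_y(a₁) | Lie) = ∏ (T − c_i)^{m_i}` at the Ω-points and the COUNT `Σ_{i : c̄_i = 1} m_i = 1`.
Every step of that chain except the last is count-free (Kottwitz descends to the valuation ring `R` ★ `lieCharpoly_extendPoint_eq_prod`; base change
to `κ̄(w)` ★ FILE 1 `charpoly_cotangentMap_baseChange_i`; transport along «reduction of points = reduction of tuples» ★
`exists_iso_fibre_special_along_extendPoint` + ★ `charpoly_cotangentMap_eq_of_comp_eq_nsmul`), and the last step is the rank formula for an
IDEMPOTENT endomorphism, `rk E = mult_1 χ_E = Σ_{i : c_i = 1} m_i` (★ (S-T-A) `finrank_range_eq_sum_of_charpoly_eq_prod`, [KnusEtAl1998] §7.B (7.9)),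
with `ι(a_n)^* = ι(a₁)^*` in characteristic `p` (★ DEAL 11 `cotangentMap_i_blockIdempotent_eq`).  Hence the GENERIC statement «rank = count» at
every special point of a smooth proper model; COUNT `0` (no embedding inducing the block has `r_τ ≠ 0` — an ÉTALE banal block of an unmixed frame,
★ `F0P6aKottwitzUnmixedFrame`) gives rank `0`, the `hsig0` binder of ★ `frobKernelBanal_of_lieSignature_zero` (for the `u`-family) and of ★
`frobKernelBanal_of_conj_lieSignature_zero` (for the conjugate family `a_n†`, a block family of `u†` — §3 `blockFamily_map`).

* §1 `finrank_range_cotangentMap_eq_sum_of_charpoly_eq_prod` (field point: `hχ ⇒ ∀ n ≥ 1, rk ι(a_n)^* = Σ_{c_i = 1} m_i`),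
  `finrank_range_cotangentMap_baseChange_eq_sum_of_lieCharpoly_eq_prod` (local base `R₀`, field-valued point `φ`: `= Σ_{φ(c_i) = 1} m_i`).
* §2 `sum_filter_residue_eq` (the count read through `κ(R) ≅ κ̄(w)`), **`finrank_range_specialFibre_geomReductionMap_eq_sum`** (at a reduction `red y`).
* §3 **`finrank_range_specialFibre_eq_sum_of_isSmoothProper`** (at EVERY `x̄` of a smooth proper model: `= Σ_{i : c̄_i = 1} m_i`),
  **`finrank_range_specialFibre_eq_zero_of_isSmoothProper`** (count `0` ⇒ rank `0`, residue currency) and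
  **`finrank_range_specialFibre_eq_zero_of_forall_ker_eq`** (the same with `c_i := ψ_i(a₁)` for ring maps `ψ_i : O → R` and the hypothesis
  «`ker (residue ∘ ψ_i) = w′ ⇒ m_i = 0`», ★ `map_blockIdempotent_one_eq_one_iff`); ring side `blockFamily_map` (a block family pushes forward along a
  ring endomorphism fixing `p`, e.g. complex conjugation: `a_n†` is a block family of `w′†`).

## References
* [Kottwitz1992] R. E. Kottwitz, *Points on some Shimura varieties over finite fields*, JAMS 5 (1992), §5 (p. 390).
* [RapoportSmithlingZhang2020Diagonal] M. Rapoport, B. Smithling, W. Zhang, Compos. Math. 156 (2020), §4.1 (4.5)–(4.6) p. 16, (4.19) p. 19.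
* [Liu2021] Y. Liu, *Fourier–Jacobi cycles and arithmetic relative trace formula*, Camb. J. Math. 9 (2021), Remark C.2 p. 108, p. 137.
* [KnusEtAl1998] M.-A. Knus, A. Merkurjev, M. Rost, J.-P. Tignol, *The Book of Involutions* (1998), §7.B Prop. (7.9).
* [SerreTate1968] J.-P. Serre, J. Tate, *Good reduction of abelian varieties*, Ann. of Math. 88 (1968), §1 (the reduction map).
* [Neukirch1999] J. Neukirch, *Algebraic Number Theory* (1999), Ch. I §3 (3.6), Ch. I §8.
-/

set_option autoImplicit false

noncomputable section

set_option backward.isDefEq.respectTransparency false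

open CategoryTheory CategoryTheory.Limits AlgebraicGeometry MonoidalCategory CartesianMonoidalCategory Polynomial
open scoped MonObj NumberField CategoryTheory.Obj

universe u v

/-! ## §1 The count-generic rank at a field point and over a local base -/

namespace Literature.AlgebraicGeometry.AbelianSchemes.AbelianSchemeOver.RingAction

open Literature.AlgebraicGeometry.Motives Literature.AlgebraicGeometry.Motives.AbelianVariety
open Literature.RingTheory.DedekindDomain Literature.LinearAlgebra

section FieldPoint

variable {k : Type u} [Field k] {𝒜 : AbelianSchemeOver (Spec (.of k))} {O : Type v} [CommRing O] (act : RingAction O 𝒜)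
  {p : ℕ} {w 𝔟 : Ideal O} {e : ℕ} (hx : Ideal.span {(p : O)} = w ^ e * 𝔟) (hcop : w ⊔ 𝔟 = ⊤)
  (a : ℕ → O) (ha1 : ∀ n, a n - 1 ∈ w ^ (e * n)) (ha2 : ∀ n, a n ∈ 𝔟 ^ n)

include hx hcop ha1 ha2 in
/-- **RANK = COUNT AT A FIELD POINT.**  If `char(ι(a₁)^* | 𝔪_e∕𝔪_e²) = ∏_{i∈s} (T − c_i)^{m_i}` over `k` (characteristic `p`), then for every `n ≥ 1` the
cotangent map of `ι(a_n)` has rank `Σ_{i : c_i = 1} m_i` (`ι(a_n)^* = ι(a₁)^*` ★ `cotangentMap_i_blockIdempotent_eq`; `ι(a₁)^*` idempotent ★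
`isIdempotentElem_cotangentMap_i_blockIdempotent`; ★ (S-T-A) `finrank_range_eq_sum_of_charpoly_eq_prod`).  The count-generic twin of ★ FILE 1
`hsig_of_charpoly_cotangentMap_eq_prod`. [cite: Kottwitz1992, §5 (p. 390)] [cite: KnusEtAl1998, §7.B Prop. (7.9)]
[cite: RapoportSmithlingZhang2020Diagonal, §4.1 (4.6) p. 16 and (4.19) p. 19] -/
theorem finrank_range_cotangentMap_eq_sum_of_charpoly_eq_prod [IsCommMonObj 𝒜.X] [CharP k p] [DecidableEq k] {σ : Type*} [DecidableEq σ]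
    (s : Finset σ) (c : σ → k) (m : σ → ℕ)
    (hχ : haveI := act.isMonHom_i (a 1)
      (cotangentMap 𝒜.toAffine.toAbelianVariety (InducedCategory.homMk (Grp.ofHom (A := 𝒜.X) (B := 𝒜.X) (act.i (a 1))))).charpoly =
        ∏ i ∈ s, (Polynomial.X - C (c i)) ^ m i) :
    ∀ n, 0 < n → haveI := act.isMonHom_i (a n)
      Module.finrank k (LinearMap.range (cotangentMap 𝒜.toAffine.toAbelianVariety
        (InducedCategory.homMk (Grp.ofHom (A := 𝒜.X) (B := 𝒜.X) (act.i (a n)))))) = ∑ i ∈ s with c i = 1, m i := by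
  intro n hn
  haveI := act.isMonHom_i (a n)
  haveI := act.isMonHom_i (a 1)
  rw [act.cotangentMap_i_blockIdempotent_eq hx hcop a ha1 ha2 n hn]
  exact finrank_range_eq_sum_of_charpoly_eq_prod (act.isIdempotentElem_cotangentMap_i_blockIdempotent hx hcop a ha1 ha2) s c m hχ

end FieldPoint

/-- **RANK = COUNT OVER A LOCAL BASE.**  `𝒜 → Spec R₀` of relative dimension `g` over a LOCAL ring with a ring action of `O`, block family `(a_n)`;
KOTTWITZ over `R₀`: `char(T, ι(a₁) | Lie(𝒜∕R₀)) = ∏_{i∈s} (T − c_i)^{m_i}`, `c_i ∈ R₀`; `φ : R₀ → κ` a field-valued point of characteristic `p`.  Then for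
every `n ≥ 1` the cotangent map of `ι_φ(a_n)` on `𝔪_e∕𝔪_e²(𝒜_φ)` has rank `Σ_{i : φ(c_i) = 1} m_i` (★ FILE 1 `charpoly_cotangentMap_baseChange_i` + §1).
The count-generic twin of ★ FILE 1 `hsig_baseChange_of_lieCharpoly_eq_prod`. [cite: Kottwitz1992, §5 (p. 390)]
[cite: RapoportSmithlingZhang2020Diagonal, §4.1 (4.6) p. 16 and (4.19) p. 19] -/
theorem finrank_range_cotangentMap_baseChange_eq_sum_of_lieCharpoly_eq_prod {R : Type u} [CommRing R] [IsLocalRing R]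
    {𝒜 : AbelianSchemeOver (Spec (.of R))}
    {g : ℕ} (h𝒜 : 𝒜.IsOfRelDim g) {O : Type v} [CommRing O] (act : RingAction O 𝒜)
    {p : ℕ} {w 𝔟 : Ideal O} {e : ℕ} (hx : Ideal.span {(p : O)} = w ^ e * 𝔟) (hcop : w ⊔ 𝔟 = ⊤)
    (a : ℕ → O) (ha1 : ∀ n, a n - 1 ∈ w ^ (e * n)) (ha2 : ∀ n, a n ∈ 𝔟 ^ n)
    {σ : Type*} [DecidableEq σ] (s : Finset σ) (c : σ → R) (m : σ → ℕ)
    (hK : haveI := act.isMonHom_i (a 1)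
      AbelianScheme.lieCharpoly 𝒜.toAffine h𝒜 (act.i (a 1)) (𝒜.toAffine.unit_left_comp_left (act.i (a 1))) = ∏ i ∈ s, (Polynomial.X - C (c i)) ^ m i)
    {κ : Type u} [Field κ] [DecidableEq κ] [CharP κ p] (gκ : Spec (.of κ) ⟶ Spec (.of R)) (φ : R →+* κ)
    (hφ : gκ = Spec.map (CommRingCat.ofHom φ)) [IsCommMonObj (𝒜.baseChange gκ).X] :
    ∀ n, 0 < n → haveI := (act.baseChange gκ).isMonHom_i (a n)
      Module.finrank κ (LinearMap.range (cotangentMap (𝒜.baseChange gκ).toAffine.toAbelianVariety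
        (InducedCategory.homMk (Grp.ofHom (A := (𝒜.baseChange gκ).X) (B := (𝒜.baseChange gκ).X) ((act.baseChange gκ).i (a n)))))) =
        ∑ i ∈ s with φ (c i) = 1, m i := by
  have hχ := act.charpoly_cotangentMap_baseChange_i h𝒜 (a 1) gκ φ hφ
  rw [hK, Polynomial.map_prod] at hχ
  simp only [Polynomial.map_pow, Polynomial.map_sub, Polynomial.map_X, Polynomial.map_C] at hχ
  exact (act.baseChange gκ).finrank_range_cotangentMap_eq_sum_of_charpoly_eq_prod hx hcop a ha1 ha2 s (fun i => φ (c i)) m hχ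

end Literature.AlgebraicGeometry.AbelianSchemes.AbelianSchemeOver.RingAction

/-! ## §2 The count-generic rank at the special points of an integral model -/

namespace Literature.AlgebraicGeometry.HodgeTheory

namespace RingAction

open Literature.AlgebraicGeometry.AbelianSchemes Literature.AlgebraicGeometry.AbelianSchemes.AbelianSchemeOver
open Literature.AlgebraicGeometry.AbelianSchemes.AbelianSchemeOver.RingAction
open Literature.AlgebraicGeometry.Motives Literature.AlgebraicGeometry.Motives.AbelianVariety
open Literature.RingTheory.DedekindDomain
open IsDedekindDomain IsDedekindDomain.HeightOneSpectrum
open Literature.NumberTheory.EllipticCurves (genericFibre specGenericPoint)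
open Literature.NumberTheory.GaloisRepresentations (closureValuationSubring)
open Literature.NumberTheory.DiophantineGeometry

section Reduction

variable {F : Type} [Field F] [NumberField F] {w : HeightOneSpectrum (𝓞 F)} {Y : SchemeOver F}
  (𝓨 : IntegralModel (valuationSubringAtPrime F w) F Y) [IsProper 𝓨.total.hom]
  {𝒜 : AbelianSchemeOver 𝓨.total.left} {g : ℕ} (hg : 𝒜.IsOfRelDim g)
  {O : Type v} [CommRing O] (act : RingAction O 𝒜)
  {p : ℕ} {w' 𝔟 : Ideal O} {e : ℕ} (hx : Ideal.span {(p : O)} = w' ^ e * 𝔟) (hcop : w' ⊔ 𝔟 = ⊤)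
  (a : ℕ → O) (ha1 : ∀ n, a n - 1 ∈ w' ^ (e * n)) (ha2 : ∀ n, a n ∈ 𝔟 ^ n)
  (y : AlgPoints Y (AlgebraicClosure (w.adicCompletion F))) {σ : Type*} (s : Finset σ)
  (c : σ → ↥(closureValuationSubring (w.adicCompletion F))) (m : σ → ℕ)
  (hK₁ : letI ιη := 𝓨.genericIso'.inv.left ≫ pullback.fst 𝓨.total.hom (specGenericPoint (valuationSubringAtPrime F w) F)
    haveI := ((act.baseChange ιη).baseChange y.left).isMonHom_i (a 1)
    (cotangentMap ((𝒜.baseChange ιη).baseChange y.left).toAffine.toAbelianVariety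
        (InducedCategory.homMk (Grp.ofHom (A := ((𝒜.baseChange ιη).baseChange y.left).X) (B := ((𝒜.baseChange ιη).baseChange y.left).X)
          (((act.baseChange ιη).baseChange y.left).i (a 1))))).charpoly =
      ∏ i ∈ s, (Polynomial.X - Polynomial.C (algebraMap ↥(closureValuationSubring (w.adicCompletion F))
        (AlgebraicClosure (w.adicCompletion F)) (c i))) ^ m i)
  [CharP (geomResidueField w) p] [DecidableEq (IsLocalRing.ResidueField ↥(closureValuationSubring (w.adicCompletion F)))]
  [IsCommMonObj (((𝒜.baseChange (pullback.fst 𝓨.total.hom (specResidueField w))).baseChange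
    ((𝓨.geomReductionMap y).left : Spec (.of (geomResidueField w)) ⟶ pullback 𝓨.total.hom (specResidueField w))).X)]

omit [IsProper 𝓨.total.hom] in
/-- The count read through `κ(R) ≅ κ̄(w)`: `Σ_{i : φκ(c_i) = 1} m_i = Σ_{i : c_i ≡ 1 mod 𝔪_R} m_i` (count-free form of ★ FILE 2 `sum_filter_residue_eq_one`).
[cite: Liu2021, Remark C.2 p. 108; p. 137] -/
theorem sum_filter_residue_eq [DecidableEq (geomResidueField w)] :
    ∑ i ∈ s with (((geomResidueFieldEquiv w).symm.toRingEquiv.toRingHom).comp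
        (IsLocalRing.residue ↥(closureValuationSubring (w.adicCompletion F)))) (c i) = 1, m i =
      ∑ i ∈ s with IsLocalRing.residue ↥(closureValuationSubring (w.adicCompletion F)) (c i) = 1, m i := by
  refine Finset.sum_congr (Finset.filter_congr fun i _ => ?_) fun _ _ => rfl
  change (geomResidueFieldEquiv w).symm (IsLocalRing.residue _ (c i)) = 1 ↔ _
  exact map_eq_one_iff _ (geomResidueFieldEquiv w).symm.injective

include hg hx hcop ha1 ha2 hK₁ in
/-- **RANK = COUNT AT A REDUCTION `red_𝓨 y`.**  `𝓨` a proper integral model over `𝒪_{F,(w)}` of `Y`, `𝒜 → 𝓨` an abelian scheme of relative dimension `g`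
with a ring action of `O`, `(p) = w′^e 𝔟`, `w′ + 𝔟 = O`, `(a_n)` a block family, `y ∈ Y(F̄_w)`; INPUT (K-Ω): on the Ω-fibre tuple at `y` the cotangent map
of `ι_y(a₁)` has characteristic polynomial `∏_{i∈s} (T − c_i)^{m_i}` with roots `c_i` in the valuation ring `R`.  Then on the datum's special fibre at `red y`
(`(𝒜 ×_𝓨 𝓨_s) ×_{𝓨_s} red y`, the `sch₀Of ∕ act₀Of` shape) the cotangent map of `ι(a_n)`, `n ≥ 1`, has rank `Σ_{i : c_i ≡ 1 mod 𝔪_R} m_i`.  PROOF = ★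
FILE 2 `hsig_specialFibre_geomReductionMap` verbatim up to the last line (Kottwitz descends to `R` ★ `lieCharpoly_extendPoint_eq_prod`; base change to
`κ̄(w)` ★ `charpoly_cotangentMap_baseChange_i`; transport along ★ `exists_iso_fibre_special_along_extendPoint` by ★ `charpoly_cotangentMap_eq_of_comp_eq_nsmul`),
then §1. [cite: RapoportSmithlingZhang2020Diagonal, §4.1 (4.6) p. 16 and (4.19) p. 19] [cite: Liu2021, Remark C.2 p. 108; p. 137] [cite: SerreTate1968, §1]
[cite: Kottwitz1992, §5 (p. 390)] -/
theorem finrank_range_specialFibre_geomReductionMap_eq_sum (n : ℕ) (hn : 0 < n) :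
    letI ιs := pullback.fst 𝓨.total.hom (specResidueField w)
    letI xb : Spec (.of (geomResidueField w)) ⟶ pullback 𝓨.total.hom (specResidueField w) := (𝓨.geomReductionMap y).left
    haveI := ((act.baseChange ιs).baseChange xb).isMonHom_i (a n)
    Module.finrank (geomResidueField w) (LinearMap.range (cotangentMap ((𝒜.baseChange ιs).baseChange xb).toAffine.toAbelianVariety
      (InducedCategory.homMk (Grp.ofHom (A := ((𝒜.baseChange ιs).baseChange xb).X) (B := ((𝒜.baseChange ιs).baseChange xb).X)
        (((act.baseChange ιs).baseChange xb).i (a n)))))) =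
      ∑ i ∈ s with IsLocalRing.residue ↥(closureValuationSubring (w.adicCompletion F)) (c i) = 1, m i := by
  classical
  obtain ⟨eI, -, hnat⟩ := exists_iso_fibre_special_along_extendPoint 𝓨 y
  let xt : Spec (.of ↥(closureValuationSubring (w.adicCompletion F))) ⟶ 𝓨.total.left :=
    (extendPoint (closureValuationSubring (w.adicCompletion F)) (toClosureValuationSubring w) 𝓨.total (𝓨.modelPointsEquiv.symm y)).left
  let gκ : Spec (.of (geomResidueField w)) ⟶ Spec (.of ↥(closureValuationSubring (w.adicCompletion F))) :=
    (geomClosedPointIsoSpecResidueField w).inv.left ≫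
      (specRingHomι (closureValuationSubring (w.adicCompletion F)) (toClosureValuationSubring w)
        (IsLocalRing.residue ↥(closureValuationSubring (w.adicCompletion F)))).left
  let φκ : ↥(closureValuationSubring (w.adicCompletion F)) →+* geomResidueField w :=
    ((geomResidueFieldEquiv w).symm.toRingEquiv.toRingHom).comp (IsLocalRing.residue ↥(closureValuationSubring (w.adicCompletion F)))
  let ιs := pullback.fst 𝓨.total.hom (specResidueField w)
  let xb : Spec (.of (geomResidueField w)) ⟶ pullback 𝓨.total.hom (specResidueField w) := (𝓨.geomReductionMap y).left
  haveI := act.isMonHom_i (a 1)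
  haveI := ((act.baseChange xt).baseChange gκ).isMonHom_i (a 1)
  haveI := ((act.baseChange ιs).baseChange xb).isMonHom_i (a 1)
  -- Kottwitz over `R`, then `hχ` on the lifted special fibre (★ FILE 1 §1)
  have hKR := lieCharpoly_extendPoint_eq_prod 𝓨 hg act y (a 1) s c m hK₁
  have hχL := (act.baseChange xt).charpoly_cotangentMap_baseChange_i (hg.baseChange xt) (a 1) gκ φκ specialPoint_eq_specMap
  rw [hKR, Polynomial.map_prod] at hχL
  simp only [Polynomial.map_pow, Polynomial.map_sub, Polynomial.map_X, Polynomial.map_C] at hχL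
  -- transport along the equivariant isomorphism `sch₀ ≅ lifted special fibre`
  have hu : (InducedCategory.homMk (Grp.ofHom (A := ((𝒜.baseChange ιs).baseChange xb).X) (B := ((𝒜.baseChange ιs).baseChange xb).X)
        (((act.baseChange ιs).baseChange xb).i (a 1))) :
          ((𝒜.baseChange ιs).baseChange xb).toAffine.toAbelianVariety ⟶ ((𝒜.baseChange ιs).baseChange xb).toAffine.toAbelianVariety) ≫
        (eI 𝒜).hom =
      (eI 𝒜).hom ≫ (InducedCategory.homMk (Grp.ofHom (A := ((𝒜.baseChange xt).baseChange gκ).X) (B := ((𝒜.baseChange xt).baseChange gκ).X)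
        (((act.baseChange xt).baseChange gκ).i (a 1))) :
          ((𝒜.baseChange xt).baseChange gκ).toAffine.toAbelianVariety ⟶ ((𝒜.baseChange xt).baseChange gκ).toAffine.toAbelianVariety) := by
    rw [homMk_baseChange_i_eq_fibreHom act ιs xb (a 1), homMk_baseChange_i_eq_fibreHom act xt gκ (a 1)]
    exact hnat 𝒜 𝒜 (act.i (a 1))
  have i1 : (eI 𝒜).hom ≫ (eI 𝒜).inv = (1 : ℕ) • 𝟙 _ := by rw [one_smul]; exact (eI 𝒜).hom_inv_id
  have i2 : (eI 𝒜).inv ≫ (eI 𝒜).hom = (1 : ℕ) • 𝟙 _ := by rw [one_smul]; exact (eI 𝒜).inv_hom_id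
  have hχ0 := charpoly_cotangentMap_eq_of_comp_eq_nsmul i1 i2 (by rw [Nat.cast_one]; exact one_ne_zero) hu
  have hχ : (cotangentMap ((𝒜.baseChange ιs).baseChange xb).toAffine.toAbelianVariety
      (InducedCategory.homMk (Grp.ofHom (A := ((𝒜.baseChange ιs).baseChange xb).X) (B := ((𝒜.baseChange ιs).baseChange xb).X)
        (((act.baseChange ιs).baseChange xb).i (a 1))))).charpoly =
      ∏ i ∈ s, (Polynomial.X - Polynomial.C (φκ (c i))) ^ m i :=
    hχ0.trans hχL
  rw [← sum_filter_residue_eq s c m]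
  exact ((act.baseChange ιs).baseChange xb).finrank_range_cotangentMap_eq_sum_of_charpoly_eq_prod hx hcop a ha1 ha2 s (fun i => φκ (c i)) m
    hχ n hn

end Reduction

/-! ## §3 At EVERY special point of a smooth proper model; the banal (count `0`) corollary -/

/-- **RANK = COUNT AT EVERY SPECIAL POINT OF A SMOOTH PROPER MODEL.**  For a smooth proper integral model `𝓨` over `𝒪_{F,(w)}`, an abelian scheme
`𝒜 → 𝓨` of relative dimension `g` with a ring action of `O`, block data `(p, e, 𝔟, a)` of `w′`, the Kottwitz input (K-Ω) at EVERY `y ∈ Y(F̄_w)` with roots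
`c_i ∈ R`, and ANY `x̄ ∈ 𝓨_s(κ̄(w))`: the cotangent map of `ι(a_n)` on `𝔪_e∕𝔪_e²` of `((𝒜 ×_𝓨 𝓨_s) ×_{𝓨_s} x̄)` has rank `Σ_{i : c_i ≡ 1 mod 𝔪_R} m_i`
for every `n ≥ 1` (every special point is a reduction, ★ `IntegralModel.geomReductionMap_surjective_of_isSmoothProper`, then §2).  The count-generic twin
of ★ FILE 2 `hsig_specialFibre_of_isSmoothProper` (same binders, minus `h1`). [cite: RapoportSmithlingZhang2020Diagonal, §4.1 (4.6) p. 16 and (4.19) p. 19]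
[cite: Liu2021, Remark C.2 p. 108; p. 137] [cite: SerreTate1968, §1] -/
theorem finrank_range_specialFibre_eq_sum_of_isSmoothProper {F : Type} [Field F] [NumberField F] {w : HeightOneSpectrum (𝓞 F)}
    {Y : SchemeOver F} (𝓨 : IntegralModel (valuationSubringAtPrime F w) F Y) {d : ℕ} (h𝓨 : 𝓨.IsSmoothProper d)
    {𝒜 : AbelianSchemeOver 𝓨.total.left} {g : ℕ} (hg : 𝒜.IsOfRelDim g)
    {O : Type v} [CommRing O] (act : RingAction O 𝒜)
    {p : ℕ} {w' 𝔟 : Ideal O} {e : ℕ} (hx : Ideal.span {(p : O)} = w' ^ e * 𝔟) (hcop : w' ⊔ 𝔟 = ⊤)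
    (a : ℕ → O) (ha1 : ∀ n, a n - 1 ∈ w' ^ (e * n)) (ha2 : ∀ n, a n ∈ 𝔟 ^ n)
    {σ : Type*} (s : Finset σ) (c : σ → ↥(closureValuationSubring (w.adicCompletion F))) (m : σ → ℕ)
    (hK : haveI : IsProper 𝓨.total.hom := h𝓨.2
      ∀ y : AlgPoints Y (AlgebraicClosure (w.adicCompletion F)),
      letI ιη := 𝓨.genericIso'.inv.left ≫ pullback.fst 𝓨.total.hom (specGenericPoint (valuationSubringAtPrime F w) F)
      haveI := ((act.baseChange ιη).baseChange y.left).isMonHom_i (a 1)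
      (cotangentMap ((𝒜.baseChange ιη).baseChange y.left).toAffine.toAbelianVariety
          (InducedCategory.homMk (Grp.ofHom (A := ((𝒜.baseChange ιη).baseChange y.left).X) (B := ((𝒜.baseChange ιη).baseChange y.left).X)
            (((act.baseChange ιη).baseChange y.left).i (a 1))))).charpoly =
        ∏ i ∈ s, (Polynomial.X - Polynomial.C (algebraMap ↥(closureValuationSubring (w.adicCompletion F))
          (AlgebraicClosure (w.adicCompletion F)) (c i))) ^ m i)
    [CharP (geomResidueField w) p] [DecidableEq (IsLocalRing.ResidueField ↥(closureValuationSubring (w.adicCompletion F)))]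
    (xbar : AlgPoints 𝓨.reductionAt (geomResidueField w))
    [IsCommMonObj (((𝒜.baseChange (pullback.fst 𝓨.total.hom (specResidueField w))).baseChange
      (xbar.left : Spec (.of (geomResidueField w)) ⟶ pullback 𝓨.total.hom (specResidueField w))).X)]
    (n : ℕ) (hn : 0 < n) :
    letI ιs := pullback.fst 𝓨.total.hom (specResidueField w)
    letI xb : Spec (.of (geomResidueField w)) ⟶ pullback 𝓨.total.hom (specResidueField w) := xbar.left
    haveI := ((act.baseChange ιs).baseChange xb).isMonHom_i (a n)
    Module.finrank (geomResidueField w) (LinearMap.range (cotangentMap ((𝒜.baseChange ιs).baseChange xb).toAffine.toAbelianVariety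
      (InducedCategory.homMk (Grp.ofHom (A := ((𝒜.baseChange ιs).baseChange xb).X) (B := ((𝒜.baseChange ιs).baseChange xb).X)
        (((act.baseChange ιs).baseChange xb).i (a n)))))) =
      ∑ i ∈ s with IsLocalRing.residue ↥(closureValuationSubring (w.adicCompletion F)) (c i) = 1, m i := by
  haveI := h𝓨.2
  obtain ⟨y, rfl⟩ := 𝓨.geomReductionMap_surjective_of_isSmoothProper h𝓨 xbar
  exact finrank_range_specialFibre_geomReductionMap_eq_sum 𝓨 hg act hx hcop a ha1 ha2 y s c m (hK y) n hn

/-- **COUNT `0` ⇒ LIE RANK `0` AT EVERY SPECIAL POINT** (residue currency): with the data of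
`finrank_range_specialFibre_eq_sum_of_isSmoothProper` and `m_i = 0` whenever `c_i ≡ 1 mod 𝔪_R`, the cotangent map of `ι(a_n)` on the special fibre at
`x̄` has rank `0` for every `n ≥ 1` — «the `w′`-block of `Lie A_x̄` VANISHES»: the `hsig0` binder of ★ `frobKernelBanal_of_lieSignature_zero` ∕ ★
`etale_block_of_lieSignature_zero` for an ÉTALE banal block. [cite: RapoportSmithlingZhang2020Diagonal, §4.1 (4.6) p. 16 and p. 17]
[cite: Kottwitz1992, §5 (p. 390)] [cite: Liu2021, Remark C.2 p. 108; p. 137] -/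
theorem finrank_range_specialFibre_eq_zero_of_isSmoothProper {F : Type} [Field F] [NumberField F] {w : HeightOneSpectrum (𝓞 F)}
    {Y : SchemeOver F} (𝓨 : IntegralModel (valuationSubringAtPrime F w) F Y) {d : ℕ} (h𝓨 : 𝓨.IsSmoothProper d)
    {𝒜 : AbelianSchemeOver 𝓨.total.left} {g : ℕ} (hg : 𝒜.IsOfRelDim g)
    {O : Type v} [CommRing O] (act : RingAction O 𝒜)
    {p : ℕ} {w' 𝔟 : Ideal O} {e : ℕ} (hx : Ideal.span {(p : O)} = w' ^ e * 𝔟) (hcop : w' ⊔ 𝔟 = ⊤)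
    (a : ℕ → O) (ha1 : ∀ n, a n - 1 ∈ w' ^ (e * n)) (ha2 : ∀ n, a n ∈ 𝔟 ^ n)
    {σ : Type*} (s : Finset σ) (c : σ → ↥(closureValuationSubring (w.adicCompletion F))) (m : σ → ℕ)
    (hK : haveI : IsProper 𝓨.total.hom := h𝓨.2
      ∀ y : AlgPoints Y (AlgebraicClosure (w.adicCompletion F)),
      letI ιη := 𝓨.genericIso'.inv.left ≫ pullback.fst 𝓨.total.hom (specGenericPoint (valuationSubringAtPrime F w) F)
      haveI := ((act.baseChange ιη).baseChange y.left).isMonHom_i (a 1)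
      (cotangentMap ((𝒜.baseChange ιη).baseChange y.left).toAffine.toAbelianVariety
          (InducedCategory.homMk (Grp.ofHom (A := ((𝒜.baseChange ιη).baseChange y.left).X) (B := ((𝒜.baseChange ιη).baseChange y.left).X)
            (((act.baseChange ιη).baseChange y.left).i (a 1))))).charpoly =
        ∏ i ∈ s, (Polynomial.X - Polynomial.C (algebraMap ↥(closureValuationSubring (w.adicCompletion F))
          (AlgebraicClosure (w.adicCompletion F)) (c i))) ^ m i)
    [CharP (geomResidueField w) p] [DecidableEq (IsLocalRing.ResidueField ↥(closureValuationSubring (w.adicCompletion F)))]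
    (h0 : ∀ i ∈ s, IsLocalRing.residue ↥(closureValuationSubring (w.adicCompletion F)) (c i) = 1 → m i = 0)
    (xbar : AlgPoints 𝓨.reductionAt (geomResidueField w))
    [IsCommMonObj (((𝒜.baseChange (pullback.fst 𝓨.total.hom (specResidueField w))).baseChange
      (xbar.left : Spec (.of (geomResidueField w)) ⟶ pullback 𝓨.total.hom (specResidueField w))).X)]
    (n : ℕ) (hn : 0 < n) :
    letI ιs := pullback.fst 𝓨.total.hom (specResidueField w)
    letI xb : Spec (.of (geomResidueField w)) ⟶ pullback 𝓨.total.hom (specResidueField w) := xbar.left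
    haveI := ((act.baseChange ιs).baseChange xb).isMonHom_i (a n)
    Module.finrank (geomResidueField w) (LinearMap.range (cotangentMap ((𝒜.baseChange ιs).baseChange xb).toAffine.toAbelianVariety
      (InducedCategory.homMk (Grp.ofHom (A := ((𝒜.baseChange ιs).baseChange xb).X) (B := ((𝒜.baseChange ιs).baseChange xb).X)
        (((act.baseChange ιs).baseChange xb).i (a n)))))) = 0 := by
  rw [finrank_range_specialFibre_eq_sum_of_isSmoothProper 𝓨 h𝓨 hg act hx hcop a ha1 ha2 s c m hK xbar n hn]
  refine Finset.sum_eq_zero fun i hi => ?_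
  rw [Finset.mem_filter] at hi
  exact h0 i hi.1 hi.2

/-- **COUNT `0` ⇒ LIE RANK `0`, in the spine's currency** (`c τ := τR τ (a 1)` for ring maps `τR τ : O → R`, the count read as «no `τ` inducing `w′`
carries signature»): if `m τ = 0` for every `τ ∈ s` with `ker (residue ∘ τR τ) = w′` (`w′` maximal, `e ≥ 1`; `residue (τR τ (a 1)) = 1 ↔ ker (residue ∘ τR τ)
= w′` is ★ `map_blockIdempotent_one_eq_one_iff`), then at every special point `x̄` of the smooth proper model the cotangent map of `ι(a_n)`, `n ≥ 1`, has
rank `0`.  USE (P-line feeder of row 38): `s := univ`, `τR := I.τR`, `m := I.m`, `hK := kottwitzΩ` read as in ★ `RGDInputsAt.charpoly_eq_prod_τR`, the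
hypothesis from `m_banal` ∕ `m_unmixed` on an ÉTALE banal block `u = w′`; for a MULTIPLICATIVE banal block apply it to the conjugate family `star ∘ a` of
`w′ := star u` (`blockFamily_map`) with `m_pair`. [cite: RapoportSmithlingZhang2020Diagonal, §4.1 (4.6) p. 16 and p. 17] [cite: Kottwitz1992, §5 (p. 390)]
[cite: Neukirch1999, Ch. I §8 (8.1)–(8.3)] -/
theorem finrank_range_specialFibre_eq_zero_of_forall_ker_eq {F : Type} [Field F] [NumberField F] {w : HeightOneSpectrum (𝓞 F)}
    {Y : SchemeOver F} (𝓨 : IntegralModel (valuationSubringAtPrime F w) F Y) {d : ℕ} (h𝓨 : 𝓨.IsSmoothProper d)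
    {𝒜 : AbelianSchemeOver 𝓨.total.left} {g : ℕ} (hg : 𝒜.IsOfRelDim g)
    {O : Type v} [CommRing O] (act : RingAction O 𝒜)
    {p : ℕ} {w' 𝔟 : Ideal O} [w'.IsMaximal] {e : ℕ} (he : 0 < e) (hx : Ideal.span {(p : O)} = w' ^ e * 𝔟) (hcop : w' ⊔ 𝔟 = ⊤)
    (a : ℕ → O) (ha1 : ∀ n, a n - 1 ∈ w' ^ (e * n)) (ha2 : ∀ n, a n ∈ 𝔟 ^ n)
    {σ : Type*} (s : Finset σ) (τR : σ → (O →+* ↥(closureValuationSubring (w.adicCompletion F)))) (m : σ → ℕ)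
    (hK : haveI : IsProper 𝓨.total.hom := h𝓨.2
      ∀ y : AlgPoints Y (AlgebraicClosure (w.adicCompletion F)),
      letI ιη := 𝓨.genericIso'.inv.left ≫ pullback.fst 𝓨.total.hom (specGenericPoint (valuationSubringAtPrime F w) F)
      haveI := ((act.baseChange ιη).baseChange y.left).isMonHom_i (a 1)
      (cotangentMap ((𝒜.baseChange ιη).baseChange y.left).toAffine.toAbelianVariety
          (InducedCategory.homMk (Grp.ofHom (A := ((𝒜.baseChange ιη).baseChange y.left).X) (B := ((𝒜.baseChange ιη).baseChange y.left).X)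
            (((act.baseChange ιη).baseChange y.left).i (a 1))))).charpoly =
        ∏ i ∈ s, (Polynomial.X - Polynomial.C (algebraMap ↥(closureValuationSubring (w.adicCompletion F))
          (AlgebraicClosure (w.adicCompletion F)) (τR i (a 1)))) ^ m i)
    [CharP (geomResidueField w) p] [DecidableEq (IsLocalRing.ResidueField ↥(closureValuationSubring (w.adicCompletion F)))]
    (h0 : ∀ i ∈ s, RingHom.ker ((IsLocalRing.residue ↥(closureValuationSubring (w.adicCompletion F))).comp (τR i)) = w' → m i = 0)
    (xbar : AlgPoints 𝓨.reductionAt (geomResidueField w))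
    [IsCommMonObj (((𝒜.baseChange (pullback.fst 𝓨.total.hom (specResidueField w))).baseChange
      (xbar.left : Spec (.of (geomResidueField w)) ⟶ pullback 𝓨.total.hom (specResidueField w))).X)]
    (n : ℕ) (hn : 0 < n) :
    letI ιs := pullback.fst 𝓨.total.hom (specResidueField w)
    letI xb : Spec (.of (geomResidueField w)) ⟶ pullback 𝓨.total.hom (specResidueField w) := xbar.left
    haveI := ((act.baseChange ιs).baseChange xb).isMonHom_i (a n)
    Module.finrank (geomResidueField w) (LinearMap.range (cotangentMap ((𝒜.baseChange ιs).baseChange xb).toAffine.toAbelianVariety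
      (InducedCategory.homMk (Grp.ofHom (A := ((𝒜.baseChange ιs).baseChange xb).X) (B := ((𝒜.baseChange ιs).baseChange xb).X)
        (((act.baseChange ιs).baseChange xb).i (a n)))))) = 0 := by
  haveI : CharP (IsLocalRing.ResidueField ↥(closureValuationSubring (w.adicCompletion F))) p :=
    charP_of_injective_ringHom (geomResidueFieldEquiv w).toRingEquiv.toRingHom.injective p
  refine finrank_range_specialFibre_eq_zero_of_isSmoothProper 𝓨 h𝓨 hg act hx hcop a ha1 ha2 s (fun i => τR i (a 1)) m hK
    (fun i hi h1 => h0 i hi ?_) xbar n hn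
  exact (map_blockIdempotent_one_eq_one_iff ((IsLocalRing.residue ↥(closureValuationSubring (w.adicCompletion F))).comp (τR i))
    he hx a ha1 ha2).1 h1

end RingAction

end Literature.AlgebraicGeometry.HodgeTheory

/-! ## §3′ Ring side: a block family pushes forward along a ring endomorphism fixing `p` -/

namespace Literature.RingTheory.DedekindDomain

/-- **A block family pushes forward along a ring homomorphism**: if `(p) = w′^e 𝔟`, `w′ + 𝔟 = O`, `a_n ≡ 1 (w′^{en})`, `a_n ∈ 𝔟^n` in `O` and `f : O → O′`
is a ring map, then `(f(p)) = f(w′)^e f(𝔟)`, `f(w′) + f(𝔟) = O′`, `f(a_n) ≡ 1 (f(w′)^{en})`, `f(a_n) ∈ f(𝔟)^n` for the image ideals (`Ideal.map`).  USE: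
`f := star` (complex conjugation on `𝓞_F`, `star p = p`): the conjugate family `a_n†` is a block family of the conjugate block `w′†` — the family on which ★
`frobKernelBanal_of_conj_lieSignature_zero` reads its `hsig0`. [cite: Neukirch1999, Ch. I §3 (3.6)] -/
theorem blockFamily_map {O O' : Type*} [CommRing O] [CommRing O'] (f : O →+* O') {p : ℕ} {w' 𝔟 : Ideal O} {e : ℕ}
    (hx : Ideal.span {(p : O)} = w' ^ e * 𝔟) (hcop : w' ⊔ 𝔟 = ⊤) {a : ℕ → O} (ha1 : ∀ n, a n - 1 ∈ w' ^ (e * n)) (ha2 : ∀ n, a n ∈ 𝔟 ^ n) :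
    Ideal.span {(p : O')} = (w'.map f) ^ e * 𝔟.map f ∧ w'.map f ⊔ 𝔟.map f = ⊤ ∧
      (∀ n, f (a n) - 1 ∈ (w'.map f) ^ (e * n)) ∧ ∀ n, f (a n) ∈ (𝔟.map f) ^ n := by
  refine ⟨?_, ?_, fun n => ?_, fun n => ?_⟩
  · have h := congrArg (Ideal.map f) hx
    rw [Ideal.map_span, Set.image_singleton, map_natCast, Ideal.map_mul, Ideal.map_pow] at h
    exact h
  · rw [← Ideal.map_sup, hcop, Ideal.map_top]
  · rw [← Ideal.map_pow, ← map_one f, ← map_sub]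
    exact Ideal.mem_map_of_mem f (ha1 n)
  · rw [← Ideal.map_pow]
    exact Ideal.mem_map_of_mem f (ha2 n)

end Literature.RingTheory.DedekindDomain

end
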